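import Literature.AnabelianGeometry.EtaleTheta.Discharge.Sec4NonVacuityCovering
import Literature.AnabelianGeometry.EtaleTheta.Discharge.Sec4Prop42SubBaseLiftUpToUnit
import Literature.AnabelianGeometry.EtaleTheta.Discharge.Sec4Prop42SubRefinement
import Literature.AnabelianGeometry.EtaleTheta.Discharge.Sec4Prop42SubZetaA
import Literature.AnabelianGeometry.EtaleTheta.Discharge.Sec4NonVacuityPipeline
import HarnessLib

/-!
# [EtTh] §4 with a COVERING: Prop 4.2 (iii) HOLDS at the Kummer-tower toy, by the sub-DAG
# (consistency witness, part 6 — the closers fire)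

S. Mochizuki, *The étale theta function and its Frobenioid-theoretic manifestations*, Publ. RIMS **45**
(2009) [MochizukiEtTh2009], §4, Prop 4.2 pp.88–90 (PDF), Prop 4.3 (ii)(iii) pp.90–91; sub-DAG
`plan/L2/SUBDAG-EtTh-Prop42.md` (rows L01a `RootOverCovering` — ERRATUM E2 —, L01b, L01′, L02, L03′, L04,
L05).

CONSISTENCY WITNESS, TOY — joint satisfiability; consistency ≠ faithfulness.  Sequel of
`Sec4NonVacuityCovering.lean` (p427822: the Kummer-tower toy `ToyCov.biKummerSetting` — base
`SingleObj ℕ+` = Kummer covers `t ↦ t^N` of `𝔾_m/ℂ`, `Φ = ℚ_{≥0}`, `B = ℂˣ × (ℚ_{≥0})^gp`, every object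
`μ_N`-saturated) and the POSITIVE companion of `Toy.not_prop42_iii` (p422428).  PROOF-ONLY (no definition,
no named fact, no instance, no `sorry`):

* `ToyCov.exists_pow_eq_pullFracModel_cover` — THE ROOT UPSTAIRS: along the pull-back morphism
  `φ_N = (1, t ↦ t^N, 0, 1) : A_⊙ → A_⊙` over the degree-`N` cover, `f = c·t^q` pulls back (genuine transport
  `pullFracModel`) to `c·t^{Nq} = (c^{1/N}·t^q)^N`;
* `ToyCov.saturatedRootCoverInSkeleton` (L01′), `ToyCov.rootOverCovering` (**L01a HOLDS** — the covering
  input of ERRATUM E2), `ToyCov.saturatedRefinement` (L01b FIRES through abc-iut-w4-d044's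
  `saturatedRefinement_mkOfModelCanonical_of_laws`);
* `ToyCov.prop42_iii` — **the typed Prop 4.2 (iii) HOLDS**, obtained BY THE SUB-DAG: abc-iut-w5-d134's
  `prop42_iii_mkOfModelCanonical_of_inSkeleton` (= `prop42_iii_of_subnodes_upToUnit` with the model-level
  L02 `rootFractionPair_mkOfModel`, L03′ `baseFrobeniusLiftUpToUnit_mkOfModelCanonical`, L04
  `rootSquares_mkOfModel`) fed with L01′ — a consumer test of the whole reshaped (iii)-pipeline on a
  satisfiable input;
* `ToyCov.unitRootsUpstairs` (L05: units are constants, `ℂˣ` divisible), `ToyCov.prop42_iv` (abc-iut-w4-d044's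
  `prop42_iv_mkOfModelCanonical_of_unitRootsUpstairs`), `ToyCov.prop42_i_and_ii` (abc-iut-L6-t12, `hDS :=
  Toy.coprime_cancel`), `ToyCov.prop43_ii/iii`;
* `ToyCov.sec4_props_with_roots` — Prop 4.2 (i)(ii)(iii)(iv) ∧ Prop 4.3 (ii)(iii) SIMULTANEOUSLY at ONE
  explicit setting (Thm 4.4 follows in the next part).

HONEST LIMITS as in part 6a: one base object, so pull-backs must be bijective and the exponents are
divisible — `N`-th roots of `t^q` would also exist without a cover; what is certified is that the typed
inputs L01a/L01b/L01′ are satisfiable TOGETHER with the setting axioms and that every closer of the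
(iii)/(iv) pipeline fires on them (the cover-free toy p422428 shows SOME input beyond the axioms is needed);
trivial [FrdI] vocabularies; not a curve; typed ≠ proved.  Nothing here bears on, or takes a side on,
[IUTchIII] Cor. 3.12.
-/

noncomputable section

namespace Literature.AnabelianGeometry.EtaleTheta

open CategoryTheory Opposite Literature.AlgebraicGeometry.Frobenioids
open scoped NNRat

namespace ToyCov

section Roots

/-- On groupifications the `N`-th power map induces the `N`-th power map. [folklore] -/
private theorem gpMap_powMonoidHom' (M : Type) [CommMonoid M] (N : ℕ) :
    gpMap (powMonoidHom N : M →* M) = powMonoidHom N := by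
  apply Algebra.GrothendieckGroup.lift.symm.injective
  rw [Algebra.GrothendieckGroup.lift_symm_apply, Algebra.GrothendieckGroup.lift_symm_apply]
  ext m
  change gpMap (powMonoidHom N) (Algebra.GrothendieckGroup.of m) = Algebra.GrothendieckGroup.of m ^ N
  rw [gpMap_of, powMonoidHom_apply, map_pow]

/-- `ℂˣ` is divisible: every constant has an `N`-th root. [folklore] -/
private theorem exists_pow_eq_units (c : ℂˣ) (N : ℕ+) : ∃ c' : ℂˣ, c' ^ (N : ℕ) = c := by
  obtain ⟨z, hz⟩ := IsAlgClosed.exists_pow_nat_eq (c : ℂ) (PNat.pos N)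
  have hu : IsUnit z := (isUnit_pow_iff (PNat.ne_zero N)).mp (hz ▸ c.isUnit)
  exact ⟨hu.unit, Units.ext (by simp [hz])⟩

/-- Pull-back of divisors along the degree-`N` cover is the `N`-th power map, also on `Φ(∗)^gp`.
[cite: MochizukiEtTh2009, Def 3.3 p.73] -/
theorem gpMap_pull_cover (N : ℕ+) (ξ : Algebra.GrothendieckGroup (temperedFrobenioid.Φ.carrier (op Aodot.base))) :
    gpMap (temperedFrobenioid.Φ.pull (cover Aodot.base Aodot.base N).op) ξ = ξ ^ (N : ℕ) := by
  have h : temperedFrobenioid.Φ.pull (cover Aodot.base Aodot.base N).op = powMonoidHom (N : ℕ) :=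
    MonoidHom.ext fun x => Subtype.ext rfl
  rw [h, gpMap_powMonoidHom']
  rfl

/-- The relation of the model Frobenioid for the data `(1, cover N, 0, 1)` at `A_⊙ = (∗, 0)`.
[cite: MochizukiFrdI2008, Thm. 5.2(i) p.100] -/
private theorem cover_rel (N : ℕ+) :
    Aodot.cls ^ ((1 : ℕ+) : ℕ) * Algebra.GrothendieckGroup.of (1 : temperedFrobenioid.divisorMonoid.obj (op Aodot.base)) =
      pullGp temperedFrobenioid.divisorMonoid (cover Aodot.base Aodot.base N) Aodot.cls *
        divB temperedFrobenioid.divisorMonoid temperedFrobenioid.ratFnFunctor temperedFrobenioid.divBNatTrans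
          (op Aodot.base) 1 := by
  simp only [PNat.one_coe, pow_one, map_one, mul_one]
  exact (map_one _).symm

/-- **The root upstairs**: along the pull-back morphism `φ_N = (1, t ↦ t^N, 0, 1)` over the degree-`N`
Kummer cover, `f = c·t^q` pulls back to `c·t^{Nq}`, which is the `N`-th power of `c^{1/N}·t^q` (`ℂˣ` is
divisible). [cite: MochizukiEtTh2009, Prop 4.2 p.89] -/
theorem exists_pow_eq_pullFracModel_cover (N : ℕ+) (f : temperedFrobenioid.biratUnitsModel Aodot) :
    ∃ g : temperedFrobenioid.biratUnitsModel Aodot, g ^ (N : ℕ) =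
      temperedFrobenioid.pullFracModel
        (ModelFrobenioid.mkHom Aodot Aodot 1 (cover Aodot.base Aodot.base N) 1 1 (cover_rel N)) f := by
  let v : temperedFrobenioid.ratFnFunctor.obj (op Aodot.base) := Units.val f
  obtain ⟨c', hc'⟩ := exists_pow_eq_units v.1.1.1 N
  let g₀ : temperedFrobenioid.ratFnFunctor.obj (op Aodot.base) := ⟨((c', v.1.1.2), v.1.2), v.2⟩
  refine ⟨(temperedFrobenioid.isUnit_ratFnFunctor realified.isUnit_BΛ Aodot g₀).unit, Units.ext ?_⟩
  rw [Units.val_pow_eq_pow_val, IsUnit.unit_spec, TemperedFrobenioid.coe_pullFracModel_apply]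
  apply Subtype.ext
  change ((c', v.1.1.2), v.1.2) ^ (N : ℕ) = (temperedFrobenioid.ratFnPull (cover Aodot.base Aodot.base N).op v).1
  rw [TemperedFrobenioid.coe_ratFnPull, Prod.pow_mk, Prod.pow_mk, hc', gpMap_pull_cover]
  rfl

/-- `A_⊙ = (∗, 0)` is `H_⊙`-ample (`Aut_D(∗) = 1`). [cite: MochizukiEtTh2009, Def 4.1 p.87] -/
theorem isAmple_Aodot : biKummerSetting.IsAmple Aodot :=
  ⟨trivial, fun σ _ => ⟨1, by rw [map_one, aut_eq_one _ σ]⟩⟩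

/-- Every automorphism of `A_⊙` fixes every birational unit (all automorphisms are units, and units act
trivially on `O^×(A^birat)`). [cite: MochizukiEtTh2009, Def 4.1 p.87] -/
theorem isFixedByHA_Aodot (f : biKummerSetting.biratUnits Aodot) :
    biKummerSetting.IsFixedByHA Aodot trivial f := fun σ _ => by
  change temperedFrobenioid.biratAutModel Aodot σ f = f
  rw [temperedFrobenioid.biratAutModel_eq_one_of_mem_units (mem_units Aodot σ)]
  rfl

/-- **L01′ `SaturatedRootCoverInSkeleton` HOLDS at the Kummer-tower toy** — the covering input of
Prop 4.2 (iii) (ERRATUM E2), supplied by the KUMMER COVER: for `N` and `f = c·t^q ∈ O^×(A_⊙^birat)`, the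
pull-back morphism `φ_N := (1, t ↦ t^N, 0, 1) : A_⊙ → A_⊙` over the degree-`N` cover pulls `f` back to
`c·t^{Nq} = (c^{1/N}·t^q)^N`, and `A_⊙` is Frobenius-trivial, Galois, `μ_N`-saturated (REAL) and
`(N, H_⊙, f|)`-saturated. [cite: MochizukiEtTh2009, Prop 4.2 p.89] -/
theorem saturatedRootCoverInSkeleton :
    BiKummerSetting.Prop42Sub.SaturatedRootCoverInSkeleton biKummerSetting
      (fun {_ _} φ x => temperedFrobenioid.pullFracModel φ x) := by
  intro N f
  refine ⟨Aodot, ModelFrobenioid.mkHom Aodot Aodot 1 (cover Aodot.base Aodot.base N) 1 1 (cover_rel N), fun _ => rfl,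
    ModelFrobenioid.isPullbackMorphism_of divisorMonoid_isDivisorial ratFnFunctor_isGroupLike rfl rfl,
    isFrobeniusTrivial_Aodot, trivial, isMuSaturated Aodot N, isAmple_Aodot, isFixedByHA_Aodot _,
    ⟨Aodot, Aodot, 𝟙 _, 𝟙 _, ModelFrobenioid.isPreStep_id _, ModelFrobenioid.isPreStep_id _,
      isFrobeniusTrivial_Aodot, trivial⟩, ?_⟩
  exact exists_pow_eq_pullFracModel_cover N f

/-- **L01a `RootOverCovering` HOLDS at the Kummer-tower toy** (the covering input, ERRATUM E2).
[cite: MochizukiEtTh2009, Prop 4.2 p.89] -/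
theorem rootOverCovering :
    BiKummerSetting.Prop42Sub.RootOverCovering biKummerSetting
      (fun {_ _} φ x => temperedFrobenioid.pullFracModel φ x) := fun N f => by
  obtain ⟨A', φ, -, hφ, hft, hG, hμ, hsat⟩ := saturatedRootCoverInSkeleton N f
  exact ⟨A', φ, hφ, hft, hG, hμ, hsat.cond_b⟩

/-- In `ℚ_{≥0}` (written multiplicatively), `x ≤ y` gives `x ∣ y`. [folklore] -/
private theorem dvd_of_le' {x y : (⊤ : Submonoid (Multiplicative ℚ≥0))}
    (h : Multiplicative.toAdd x.1 ≤ Multiplicative.toAdd y.1) : x ∣ y := by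
  obtain ⟨d, hd⟩ := exists_add_of_le h
  refine ⟨⟨Multiplicative.ofAdd d, trivial⟩, Subtype.ext ?_⟩
  change y.1 = x.1 * Multiplicative.ofAdd d
  apply Multiplicative.toAdd.injective
  rw [toAdd_mul, toAdd_ofAdd, hd]

/-- Coprime elements of the totally ordered sharp monoid `ℚ_{≥0}`: one of them is `0`. [folklore] -/
private theorem coprime_cases {a b : (⊤ : Submonoid (Multiplicative ℚ≥0))}
    (h : ∀ x : (⊤ : Submonoid (Multiplicative ℚ≥0)), x ∣ a → x ∣ b → x = 1) : a = 1 ∨ b = 1 := by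
  rcases le_total (Multiplicative.toAdd a.1) (Multiplicative.toAdd b.1) with hab | hba
  · exact Or.inl (h a (dvd_refl a) (dvd_of_le' hab))
  · exact Or.inr (h b (dvd_of_le' hba) (dvd_refl b))

/-- The [FrdI] Prop 4.1 (iii) coprimality predicate pulls back along every base morphism (`Φ = ℚ_{≥0}`:
"coprime" means "one of the two is `0`"). [cite: MochizukiEtTh2009, Prop 4.2 p.89] -/
theorem coprime_pull {A A' : Base} (e : A' ⟶ A) {a b : temperedFrobenioid.Φ.carrier (op A)}
    (h : ∀ x : temperedFrobenioid.Φ.carrier (op A), x ∣ a → x ∣ b → x = 1)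
    (y : temperedFrobenioid.Φ.carrier (op A')) (hya : y ∣ pull temperedFrobenioid.divisorMonoid e a)
    (hyb : y ∣ pull temperedFrobenioid.divisorMonoid e b) : y = 1 := by
  rcases coprime_cases h with ha | hb
  · have h1 : pull temperedFrobenioid.divisorMonoid e a = 1 := by rw [ha]; exact map_one _
    rw [h1] at hya
    exact (divisorMonoid_isDivisorial A').isSharp.eq_one_of_isUnit y (isUnit_of_dvd_one hya)
  · have h1 : pull temperedFrobenioid.divisorMonoid e b = 1 := by rw [hb]; exact map_one _
    rw [h1] at hyb
    exact (divisorMonoid_isDivisorial A').isSharp.eq_one_of_isUnit y (isUnit_of_dvd_one hyb)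

/-- **[EtTh] Prop 4.2 (iii) HOLDS at the Kummer-tower toy**, BY THE SUB-DAG: abc-iut-w5-d134's
`prop42_iii_mkOfModelCanonical_of_inSkeleton` (composition `prop42_iii_of_subnodes_upToUnit` of L01′ with
the model-level L02 `rootFractionPair_mkOfModel`, L03′ `baseFrobeniusLiftUpToUnit_mkOfModelCanonical`,
L04 `rootSquares_mkOfModel`) FIRES on the covering input `saturatedRootCoverInSkeleton` — so the typed
(iii), FALSE at the cover-free toy (p422428), holds here: its sub-DAG inputs are jointly satisfiable.
[cite: MochizukiEtTh2009, Prop 4.2 p.88] -/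
theorem prop42_iii :
    biKummerSetting.Prop42_iii (fun {_ _} φ x => temperedFrobenioid.pullFracModel φ x) :=
  BiKummerSetting.Prop42Sub.prop42_iii_mkOfModelCanonical_of_inSkeleton Toy.temperedGroup temperedFrobenioid
    temperedFrobenioid_monoidType temperedFrobenioid_isPerfect (fun _ => True) (fun _ _ => 1)
    galoisSurj_surjective (fun _ _ _ => True) Aodot isFrobeniusTrivial_Aodot trivial divisorMonoid_isDivisorial
    (fun e _ _ h y hya hyb => coprime_pull e h y hya hyb) saturatedRootCoverInSkeleton

/-- **L01b `SaturatedRefinement` FIRES at the Kummer-tower toy** through abc-iut-w4-d044's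
`saturatedRefinement_mkOfModelCanonical_of_laws` (refinement `ψ = id`; REAL `μ_N`-saturation of every
object; trivial Galois surjections). [cite: MochizukiEtTh2009, Prop 4.2 p.90] -/
theorem saturatedRefinement :
    BiKummerSetting.Prop42Sub.SaturatedRefinement biKummerSetting
      (fun {_ _} φ x => temperedFrobenioid.pullFracModel φ x) :=
  BiKummerSetting.saturatedRefinement_mkOfModelCanonical_of_laws Toy.temperedGroup temperedFrobenioid
    temperedFrobenioid_monoidType temperedFrobenioid_isPerfect (fun _ => True) (fun _ _ => 1)
    galoisSurj_surjective (fun _ _ _ => True) Aodot isFrobeniusTrivial_Aodot trivial divisorMonoid_isDivisorial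
    (fun N A' _ _ => ⟨A', 𝟙 A',
      ModelFrobenioid.isPullbackMorphism_of divisorMonoid_isDivisorial ratFnFunctor_isGroupLike rfl rfl, trivial,
      isMuSaturated A' N, trivial⟩)
    (fun _ _ _ _ b => ⟨1, fun g => by
      rw [MonoidHom.one_apply, MonoidHom.one_apply]
      exact (Category.id_comp _).trans (Category.comp_id _).symm⟩)

/-- **L05 `UnitRootsUpstairs` HOLDS at the Kummer-tower toy**: every unit is multiplication by a constant
and `ℂˣ` is divisible. [cite: MochizukiEtTh2009, Prop 4.2 p.90] -/
theorem unitRootsUpstairs :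
    BiKummerSetting.Prop42Sub.UnitRootsUpstairs biKummerSetting
      (fun φ x => temperedFrobenioid.pullFracModel φ x) := by
  intro B f P N R x x' _ hx' _
  let xu : ModelFrobenioid.units R.AN := ⟨x', hx'.1, hx'.2⟩
  obtain ⟨c, hc⟩ := exists_eq_cnstUnitHom R.AN xu
  obtain ⟨c', hc'⟩ := exists_pow_eq_units c N
  refine ⟨coefAut R.AN c', ⟨(coefAut_mem_units R.AN c').1, (coefAut_mem_units R.AN c').2⟩, ?_⟩
  have h : (coefUnit R.AN c') ^ (N : ℕ) = xu :=
    unitsToRatFn_injective R.AN (by rw [map_pow, unitsToRatFn_coefUnit, ← map_pow, hc', hc])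
  have h' := congrArg Subtype.val h
  rwa [SubmonoidClass.coe_pow] at h'

/-- **Prop 4.2 (iv) HOLDS at the Kummer-tower toy** (abc-iut-w4-d044's
`prop42_iv_mkOfModelCanonical_of_unitRootsUpstairs`). [cite: MochizukiEtTh2009, Prop 4.2 p.89] -/
theorem prop42_iv :
    biKummerSetting.Prop42_iv (fun φ x => temperedFrobenioid.pullFracModel φ x) :=
  BiKummerSetting.prop42_iv_mkOfModelCanonical_of_unitRootsUpstairs Toy.temperedGroup temperedFrobenioid
    temperedFrobenioid_monoidType temperedFrobenioid_isPerfect (fun _ => True) (fun _ _ => 1)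
    galoisSurj_surjective (fun _ _ _ => True) Aodot isFrobeniusTrivial_Aodot trivial divisorMonoid_isDivisorial
    unitRootsUpstairs

/-- **Prop 4.2 (i) and (ii) HOLD at the Kummer-tower toy** (abc-iut-L6-t12's `prop42_i_mkOfModel`,
`prop42_ii_mkOfModel` with `hDS := Toy.coprime_cancel`, `hDSι := coprime_pull`). [cite: MochizukiEtTh2009, Prop 4.2 p.88] -/
theorem prop42_i_and_ii : biKummerSetting.Prop42_i ∧ biKummerSetting.Prop42_ii :=
  ⟨BiKummerSetting.prop42_i_mkOfModel Toy.temperedGroup temperedFrobenioid temperedFrobenioid_monoidType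
    temperedFrobenioid_isPerfect realified.isUnit_BΛ
    (fun {A} a b => ∀ x : temperedFrobenioid.Φ.carrier A, x ∣ a → x ∣ b → x = 1) (fun _ => True)
    (fun _ _ => 1) galoisSurj_surjective (fun _ _ _ => True)
    (fun {_ _} G α₂ α₁ => temperedFrobenioid.ArisesFromBaseFrobeniusPair G α₂ α₁) Aodot
    isFrobeniusTrivial_Aodot trivial divisorMonoid_isDivisorial
    (fun h h' e => Toy.coprime_cancel h h' e),
  BiKummerSetting.prop42_ii_mkOfModel Toy.temperedGroup temperedFrobenioid temperedFrobenioid_monoidType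
    temperedFrobenioid_isPerfect realified.isUnit_BΛ
    (fun {A} a b => ∀ x : temperedFrobenioid.Φ.carrier A, x ∣ a → x ∣ b → x = 1) (fun _ => True)
    (fun _ _ => 1) galoisSurj_surjective (fun _ _ _ => True)
    (fun {_ _} G α₂ α₁ => temperedFrobenioid.ArisesFromBaseFrobeniusPair G α₂ α₁) Aodot
    isFrobeniusTrivial_Aodot trivial divisorMonoid_isDivisorial
    (fun h h' e => Toy.coprime_cancel h h' e) (fun e _ _ _ h y hya hyb => coprime_pull e h y hya hyb)⟩

/-- **Prop 4.3 (ii) HOLDS at the Kummer-tower toy** (`prop43_ii_of`). [cite: MochizukiEtTh2009, Prop 4.3 p.90] -/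
theorem prop43_ii :
    biKummerSetting.Prop43_ii fun {_ _} φ => temperedFrobenioid.pullFracModel φ :=
  biKummerSetting.prop43_ii_of divisorMonoid_isDivisorial ratFnFunctor_isGroupLike
    (fun {_ _} φ => temperedFrobenioid.pullFracModel φ)

/-- **Prop 4.3 (iii) HOLDS at the Kummer-tower toy** (`prop43_iii_mkOfModel`). [cite: MochizukiEtTh2009, Prop 4.3 p.91] -/
theorem prop43_iii :
    biKummerSetting.Prop43_iii fun {_ _} φ => temperedFrobenioid.pullFracModel φ :=
  BiKummerSetting.prop43_iii_mkOfModel Toy.temperedGroup temperedFrobenioid temperedFrobenioid_monoidType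
    temperedFrobenioid_isPerfect realified.isUnit_BΛ
    (fun {A} a b => ∀ x : temperedFrobenioid.Φ.carrier A, x ∣ a → x ∣ b → x = 1) (fun _ => True)
    (fun _ _ => 1) galoisSurj_surjective (fun _ _ _ => True)
    (fun {_ _} G α₂ α₁ => temperedFrobenioid.ArisesFromBaseFrobeniusPair G α₂ α₁) Aodot
    isFrobeniusTrivial_Aodot trivial divisorMonoid_isDivisorial
    (fun {_ _} φ => temperedFrobenioid.pullFracModel φ)

/-- **Propositions 4.2 (i)–(iv) and 4.3 (ii)(iii) hold SIMULTANEOUSLY at ONE explicit setting with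
coverings** — in particular the typed Prop 4.2 (iii) together with everything the cover-free toy already
satisfied. [cite: MochizukiEtTh2009, Prop 4.2 p.88] -/
theorem sec4_props_with_roots :
    biKummerSetting.Prop42_i ∧ biKummerSetting.Prop42_ii ∧
      biKummerSetting.Prop42_iii (fun {_ _} φ x => temperedFrobenioid.pullFracModel φ x) ∧
      biKummerSetting.Prop42_iv (fun φ x => temperedFrobenioid.pullFracModel φ x) ∧
      (biKummerSetting.Prop43_ii fun {_ _} φ => temperedFrobenioid.pullFracModel φ) ∧
      (biKummerSetting.Prop43_iii fun {_ _} φ => temperedFrobenioid.pullFracModel φ) :=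
  ⟨prop42_i_and_ii.1, prop42_i_and_ii.2, prop42_iii, prop42_iv, prop43_ii, prop43_iii⟩

end Roots

end ToyCov

end Literature.AnabelianGeometry.EtaleTheta

end
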